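import Summits.CriticalPhenomena.SAWScalingLimit.Theorems.SAWDefectDecoherenceConjugateClassNegligibleSums
import Literature.Probability.LatticeModels.ThermodynamicLimit
import HarnessLib

/-!
# Lattice counting and the black-vertex star estimate for the conjugate-class average

Route `SAWDefectDecoherence` of `CriticalPhenomena/SAWScalingLimit`, node `ConjugateClassNegligible`
(item `stmt-CriticalPhenomena-8551`); helper file for
`Theorems/SAWDefectDecoherenceConjugateClassNegligibleOfLimit.lean` (the exponent-free reduction of
the node to a continuous local limit of the normalised observable).

Contents (namespace `Summit.CriticalPhenomena.SAWScalingLimit.Theorems.ConjugateClassNegligibleOfLimit`):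
* counting honeycomb vertices under a disc: `δ² · #{v ∈ S : ‖δ c_v‖ ≤ R} ≤ 2 (4R + 11)²`
  (`sq_mul_card_filter_le`; coordinates are controlled by the embedded norm,
  `abs_le_two_mul_norm_triEmbed` of `TriangularLatticeProofs.lean`, and the cells are counted in
  the box `Literature.Probability.LatticeModels.box`);
* the star of a black vertex `(x, 0)`: its neighbours in `Λ` (`filter_adj_eq_image`, from
  `neighborSet_hexGraph_zero`), at most three of them, and the barycentre identity
  `Σ_{t ∼ v} conj(c_t - c_v) = 0` (`sum_star_conj_eq_zero`);
* the **star estimate** `star_estimate`: for an edge function `G` that is `η`-close to `f(δ·mid e)`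
  and a test function `ψ` whose product with `f` oscillates by at most `η` at scale `δ/2`, the
  `ψ`-weighted conjugate star sum `Σ_t ψ(δ·mid) conj(c_t - c_v) G({v,t})` at a black vertex is at
  most `3 (1 + ‖ψ‖_∞) η`, and vanishes unless `δ c_v` lies under the thickened support.
-/

noncomputable section

open scoped BigOperators Topology
open Filter Set Metric
open Literature.Probability.LatticeModels Literature.Probability.RandomPlanarGeometry
open Literature.Probability.RandomPlanarGeometry.SAW
open Summit.CriticalPhenomena.SAWScalingLimit.Theorems.ConjugateClassNegligibleSynthesis

namespace Summit.CriticalPhenomena.SAWScalingLimit.Theorems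

namespace ConjugateClassNegligibleOfLimit

/-! ### Counting honeycomb vertices under a compact set -/

/-- The cell of a face is controlled by the face centre: `‖triEmbed v.1‖ ≤ ‖c_v‖ + 2`
(`‖ζ‖ = 1`, cf. `Literature.Probability.Percolation.norm_triZeta`, re-derived inline from
`normSq_triZeta` to keep the imports light). [folklore] -/
theorem norm_triEmbed_le (v : HexVertex) : ‖triEmbed v.1‖ ≤ ‖hexCenter v‖ + 2 := by
  have norm_triZeta : ‖triZeta‖ = 1 := by
    have h := normSq_triZeta
    rw [Complex.normSq_eq_norm_sq] at h
    exact (pow_eq_one_iff_of_nonneg (norm_nonneg _) two_ne_zero).1 h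
  have hk : ((v.2 : ℕ) : ℝ) ≤ 1 := by
    have := v.2.is_lt
    exact_mod_cast (by omega : (v.2 : ℕ) ≤ 1)
  have hw : ‖((v.2 : ℕ) + 1 : ℂ) * (1 + triZeta) / 3‖ ≤ 2 := by
    rw [norm_div, norm_mul, RCLike.norm_ofNat,
      show ((v.2 : ℕ) + 1 : ℂ) = (((v.2 : ℕ) + 1 : ℕ) : ℂ) by push_cast; ring, Complex.norm_natCast]
    have h1 : ‖(1 : ℂ) + triZeta‖ ≤ 2 := by
      refine (norm_add_le _ _).trans ?_
      rw [norm_one, norm_triZeta]; norm_num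
    have h2 : (((v.2 : ℕ) + 1 : ℕ) : ℝ) ≤ 2 := by push_cast; linarith
    have h3 : 0 ≤ ‖(1 : ℂ) + triZeta‖ := norm_nonneg _
    calc (((v.2 : ℕ) + 1 : ℕ) : ℝ) * ‖(1 : ℂ) + triZeta‖ / 3 ≤ 2 * 2 / 3 := by gcongr
      _ ≤ 2 := by norm_num
  have heq : triEmbed v.1 = hexCenter v - ((v.2 : ℕ) + 1 : ℂ) * (1 + triZeta) / 3 := by
    rw [hexCenter]; ring
  rw [heq]
  exact (norm_sub_le _ _).trans (by linarith)

/-- Lattice coordinates are controlled by the face centre: `|v.1 i| ≤ 2 ‖c_v‖ + 4`. [folklore] -/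
theorem abs_coord_le (v : HexVertex) (i : Fin 2) : |(v.1 i : ℝ)| ≤ 2 * ‖hexCenter v‖ + 4 :=
  (abs_le_two_mul_norm_triEmbed v.1 i).trans (by linarith [norm_triEmbed_le v])

/-- At most `2 (4M + 11)²` honeycomb vertices have their centre in the disc of radius `M`. [folklore] -/
theorem card_filter_norm_le (S : Finset HexVertex) {M : ℝ} (hM : 0 ≤ M) :
    ((S.filter fun v => ‖hexCenter v‖ ≤ M).card : ℝ) ≤ 2 * (4 * M + 11) ^ 2 := by
  classical
  set N : ℕ := ⌈2 * M + 4⌉₊ with hN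
  have hsub : (S.filter fun v => ‖hexCenter v‖ ≤ M) ⊆
      Literature.Probability.LatticeModels.box 2 N ×ˢ (Finset.univ : Finset (Fin 2)) := by
    intro v hv
    rw [Finset.mem_filter] at hv
    rw [Finset.mem_product, mem_box]
    refine ⟨fun i => ?_, Finset.mem_univ _⟩
    have h1 : |(v.1 i : ℝ)| ≤ N :=
      (abs_coord_le v i).trans
        ((by linarith [hv.2] : 2 * ‖hexCenter v‖ + 4 ≤ 2 * M + 4).trans (Nat.le_ceil _))
    have h2 : |v.1 i| ≤ (N : ℤ) := by exact_mod_cast h1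
    exact abs_le.1 h2
  have hcard : (S.filter fun v => ‖hexCenter v‖ ≤ M).card ≤ (2 * N + 1) ^ 2 * 2 := by
    refine (Finset.card_le_card hsub).trans ?_
    rw [Finset.card_product, card_box, Finset.card_univ, Fintype.card_fin]
  have hN' : (N : ℝ) < 2 * M + 4 + 1 := Nat.ceil_lt_add_one (by linarith)
  have h3 : ((S.filter fun v => ‖hexCenter v‖ ≤ M).card : ℝ) ≤ (2 * N + 1) ^ 2 * 2 := by
    exact_mod_cast hcard
  have h4 : 2 * (N : ℝ) + 1 ≤ 4 * M + 11 := by linarith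
  have h5 : 0 ≤ 2 * (N : ℝ) + 1 := by positivity
  calc ((S.filter fun v => ‖hexCenter v‖ ≤ M).card : ℝ) ≤ (2 * N + 1) ^ 2 * 2 := h3
    _ ≤ (4 * M + 11) ^ 2 * 2 := by gcongr
    _ = 2 * (4 * M + 11) ^ 2 := by ring

/-- **Area count at scale `δ`.** `δ² · #{v ∈ S : ‖δ c_v‖ ≤ R} ≤ 2 (4R + 11)²` for `0 < δ ≤ 1`:
there are `O(δ⁻²)` rescaled honeycomb vertices in a fixed disc. [folklore] -/
theorem sq_mul_card_filter_le (S : Finset HexVertex) {δ R : ℝ} (hδ : 0 < δ) (hδ1 : δ ≤ 1)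
    (hR : 0 ≤ R) :
    δ ^ 2 * ((S.filter fun v => ‖(δ : ℂ) * hexCenter v‖ ≤ R).card : ℝ) ≤ 2 * (4 * R + 11) ^ 2 := by
  have hset : (S.filter fun v => ‖(δ : ℂ) * hexCenter v‖ ≤ R) =
      S.filter fun v => ‖hexCenter v‖ ≤ R / δ := by
    refine Finset.filter_congr fun v _ => ?_
    rw [norm_mul, Complex.norm_real, Real.norm_of_nonneg hδ.le, le_div_iff₀' hδ]
  rw [hset]
  have h := card_filter_norm_le S (M := R / δ) (by positivity)
  have h45 : 4 * R + 11 * δ ≤ 4 * R + 11 := by linarith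
  have h46 : 0 ≤ 4 * R + 11 * δ := by positivity
  calc δ ^ 2 * ((S.filter fun v => ‖hexCenter v‖ ≤ R / δ).card : ℝ)
      ≤ δ ^ 2 * (2 * (4 * (R / δ) + 11) ^ 2) := mul_le_mul_of_nonneg_left h (by positivity)
    _ = 2 * (4 * R + 11 * δ) ^ 2 := by field_simp
    _ ≤ 2 * (4 * R + 11) ^ 2 := by gcongr

/-! ### The star of a black vertex -/

/-- If the three neighbours of the black vertex `(x, 0)` lie in `Λ`, its neighbours in `Λ` are the
three down faces `(x, 1), (x - e₀, 1), (x - e₁, 1)`. [folklore] -/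
theorem filter_adj_eq_image (x : Site 2) {Λ : Finset HexVertex}
    (hall : ∀ t, hexGraph.Adj (x, 0) t → t ∈ Λ) :
    Λ.filter (fun t => hexGraph.Adj (x, 0) t) =
      ({0, -Pi.single 0 1, -Pi.single 1 1} : Finset (Site 2)).image
        fun u => (x + u, (1 : Fin 2)) := by
  ext t
  have key : hexGraph.Adj (x, 0) t ↔
      t ∈ ({0, -Pi.single 0 1, -Pi.single 1 1} : Finset (Site 2)).image
        fun u => (x + u, (1 : Fin 2)) := by
    rw [← SimpleGraph.mem_neighborSet, neighborSet_hexGraph_zero, Finset.mem_coe]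
  rw [Finset.mem_filter, ← key]
  exact ⟨fun h => h.2, fun h => ⟨hall t h, h⟩⟩

/-- A black vertex has at most three neighbours in `Λ`. [folklore] -/
theorem card_filter_adj_le_three (x : Site 2) (Λ : Finset HexVertex) :
    (Λ.filter fun t => hexGraph.Adj (x, 0) t).card ≤ 3 := by
  classical
  calc (Λ.filter fun t => hexGraph.Adj (x, 0) t).card
      ≤ (({0, -Pi.single 0 1, -Pi.single 1 1} : Finset (Site 2)).image
          fun u => (x + u, (1 : Fin 2))).card := by
        refine Finset.card_le_card fun t ht => ?_
        rw [Finset.mem_filter] at ht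
        have h := ht.2
        rwa [← SimpleGraph.mem_neighborSet, neighborSet_hexGraph_zero, Finset.mem_coe] at h
    _ ≤ ({0, -Pi.single 0 1, -Pi.single 1 1} : Finset (Site 2)).card := Finset.card_image_le
    _ ≤ 3 := Finset.card_le_three

/-- **The black vertex is the barycentre of its star**: the three edge vectors at `(x, 0)` sum to
zero. [folklore] -/
theorem sum_star_sub_eq_zero (x : Site 2) :
    ∑ u ∈ ({0, -Pi.single 0 1, -Pi.single 1 1} : Finset (Site 2)),
      (hexCenter (x + u, 1) - hexCenter (x, 0)) = 0 := by
  have h01 : (0 : Site 2) ≠ -Pi.single 0 1 := fun h => by simpa using congrFun h 0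
  have h02 : (0 : Site 2) ≠ -Pi.single 1 1 := fun h => by simpa using congrFun h 1
  have h12 : (-Pi.single 0 1 : Site 2) ≠ -Pi.single 1 1 := fun h => by simpa using congrFun h 0
  rw [Finset.sum_insert (by simp [h01, h02]), Finset.sum_insert (by simp [h12]),
    Finset.sum_singleton]
  simp only [hexCenter, triEmbed_add, triEmbed_neg, triEmbed_zero, triEmbed_single_zero,
    triEmbed_single_one, Fin.val_one, Fin.val_zero, Nat.cast_one, Nat.cast_zero]
  ring

/-- The conjugated edge vectors over the full star of a black vertex sum to zero. [folklore] -/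
theorem sum_star_conj_eq_zero (x : Site 2) {Λ : Finset HexVertex}
    (hall : ∀ t, hexGraph.Adj (x, 0) t → t ∈ Λ) :
    ∑ t ∈ Λ.filter (fun t => hexGraph.Adj (x, 0) t),
      (starRingEnd ℂ) (hexCenter t - hexCenter (x, 0)) = 0 := by
  rw [← map_sum, filter_adj_eq_image x hall, Finset.sum_image, sum_star_sub_eq_zero, map_zero]
  intro u _ w _ h
  exact add_left_cancel (Prod.mk.inj h).1

/-! ### The star estimate -/

/-- **Star estimate.** Let `G` be an edge function `η`-close to `f(δ·mid e)` on the domain mid-edges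
under `K₂ ⊇ (tsupport ψ)_r`, let every vertex under `K₂` belong to `Λ`, and let the oscillation of
`ψ f` at scale `δ/2` be at most `η` (`3δ ≤ 2r`). Then at a black vertex `v` the `ψ`-weighted
conjugate star sum of `G` over the neighbours of `v` in `Λ` is at most `3 (1 + ‖ψ‖_∞) η`, and it
vanishes unless `‖δ c_v‖ ≤ R₂` (`K₂ ⊆ B̄(0, R₂)`): either `ψ` kills the whole star, or the star is
complete and `Σ_t conj(c_t - c_v) = 0` recentres `ψ f` at `δ c_v`. [folklore] -/
theorem star_estimate {ψ f : ℂ → ℂ} {G : Sym2 HexVertex → ℂ} {Λ : Finset HexVertex}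
    {K₂ : Set ℂ} {Mψ η r δ R₂ : ℝ} (hMψ : ∀ z, ‖ψ z‖ ≤ Mψ) (hMψ0 : 0 ≤ Mψ) (hη : 0 ≤ η)
    (hδ : 0 < δ) (hδr : 3 * δ ≤ 2 * r) (hK₂ : cthickening r (tsupport ψ) ⊆ K₂)
    (hK₂R : K₂ ⊆ closedBall (0 : ℂ) R₂)
    (hexδ : ∀ v : HexVertex, (δ : ℂ) * hexCenter v ∈ K₂ → v ∈ Λ)
    (happ : ∀ e ∈ hexDomainMidEdges Λ, (δ : ℂ) * hexMidpoint e ∈ K₂ →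
      ‖G e - f ((δ : ℂ) * hexMidpoint e)‖ ≤ η)
    (hg : ∀ x y : ℂ, dist x y ≤ δ / 2 → ‖ψ x * f x - ψ y * f y‖ ≤ η)
    {v : HexVertex} (hv : v.2 = 0) :
    ‖∑ t ∈ Λ.filter (fun t => hexGraph.Adj v t),
        ψ ((δ : ℂ) * hexMidpoint s(v, t)) * (starRingEnd ℂ) (hexCenter t - hexCenter v) * G s(v, t)‖ ≤
      if ‖(δ : ℂ) * hexCenter v‖ ≤ R₂ then 3 * (1 + Mψ) * η else 0 := by
  classical
  obtain ⟨x, k⟩ := v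
  simp only at hv
  subst hv
  by_cases hex : ∃ t ∈ Λ.filter (fun t => hexGraph.Adj ((x, 0) : HexVertex) t),
      ψ ((δ : ℂ) * hexMidpoint s(((x, 0) : HexVertex), t)) ≠ 0
  · obtain ⟨t₀, ht₀, hψ₀⟩ := hex
    have hadj₀ : hexGraph.Adj ((x, 0) : HexVertex) t₀ := (Finset.mem_filter.1 ht₀).2
    have hmid₀ : (δ : ℂ) * hexMidpoint s(((x, 0) : HexVertex), t₀) ∈ tsupport ψ :=
      subset_tsupport _ hψ₀
    have hcv : dist ((δ : ℂ) * hexCenter ((x, 0) : HexVertex))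
        ((δ : ℂ) * hexMidpoint s(((x, 0) : HexVertex), t₀)) ≤ δ / 2 := by
      rw [dist_comm]; exact dist_mid_center_le hδ.le hadj₀
    have hvK : (δ : ℂ) * hexCenter ((x, 0) : HexVertex) ∈ K₂ :=
      mem_of_dist_le_of_mem_tsupport hK₂ hmid₀ (hcv.trans (by linarith))
    have hvR : ‖(δ : ℂ) * hexCenter ((x, 0) : HexVertex)‖ ≤ R₂ := by
      simpa only [mem_closedBall, dist_zero_right] using hK₂R hvK
    rw [if_pos hvR]
    -- every rescaled neighbour centre is within `δ` of `δ c_v`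
    have hnb : ∀ t : HexVertex, hexGraph.Adj ((x, 0) : HexVertex) t →
        dist ((δ : ℂ) * hexCenter t) ((δ : ℂ) * hexCenter ((x, 0) : HexVertex)) ≤ δ := by
      intro t ht
      rw [dist_eq_norm, ← mul_sub, norm_mul, Complex.norm_real, Real.norm_of_nonneg hδ.le]
      calc δ * ‖hexCenter t - hexCenter ((x, 0) : HexVertex)‖ ≤ δ * 1 :=
          mul_le_mul_of_nonneg_left (norm_hexCenter_sub_le_one ht) hδ.le
        _ = δ := mul_one δ
    -- the star is complete
    have hstar : ∀ t, hexGraph.Adj ((x, 0) : HexVertex) t → t ∈ Λ := by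
      intro t ht
      refine hexδ t (mem_of_dist_le_of_mem_tsupport hK₂ hmid₀ ?_)
      calc dist ((δ : ℂ) * hexCenter t) ((δ : ℂ) * hexMidpoint s(((x, 0) : HexVertex), t₀))
          ≤ dist ((δ : ℂ) * hexCenter t) ((δ : ℂ) * hexCenter ((x, 0) : HexVertex)) +
              dist ((δ : ℂ) * hexCenter ((x, 0) : HexVertex))
                ((δ : ℂ) * hexMidpoint s(((x, 0) : HexVertex), t₀)) := dist_triangle _ _ _
        _ ≤ δ + δ / 2 := add_le_add (hnb t ht) hcv
        _ ≤ r := by linarith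
    have hsum0 := sum_star_conj_eq_zero x hstar
    -- recentre at `δ c_v`
    set gv : ℂ := ψ ((δ : ℂ) * hexCenter ((x, 0) : HexVertex)) *
      f ((δ : ℂ) * hexCenter ((x, 0) : HexVertex)) with hgv
    have hrw : ∑ t ∈ Λ.filter (fun t => hexGraph.Adj ((x, 0) : HexVertex) t),
        ψ ((δ : ℂ) * hexMidpoint s(((x, 0) : HexVertex), t)) *
          (starRingEnd ℂ) (hexCenter t - hexCenter ((x, 0) : HexVertex)) * G s(((x, 0) : HexVertex), t) =
        ∑ t ∈ Λ.filter (fun t => hexGraph.Adj ((x, 0) : HexVertex) t),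
          (starRingEnd ℂ) (hexCenter t - hexCenter ((x, 0) : HexVertex)) *
            (ψ ((δ : ℂ) * hexMidpoint s(((x, 0) : HexVertex), t)) * G s(((x, 0) : HexVertex), t) - gv) := by
      simp_rw [mul_sub]
      rw [Finset.sum_sub_distrib, ← Finset.sum_mul, hsum0, zero_mul, sub_zero]
      exact Finset.sum_congr rfl fun t _ => by ring
    rw [hrw]
    -- termwise bound
    have hterm : ∀ t ∈ Λ.filter (fun t => hexGraph.Adj ((x, 0) : HexVertex) t),
        ‖(starRingEnd ℂ) (hexCenter t - hexCenter ((x, 0) : HexVertex)) *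
            (ψ ((δ : ℂ) * hexMidpoint s(((x, 0) : HexVertex), t)) * G s(((x, 0) : HexVertex), t) - gv)‖ ≤
          (1 + Mψ) * η := by
      intro t ht
      obtain ⟨htΛ, hadj⟩ := Finset.mem_filter.1 ht
      have hmidK : (δ : ℂ) * hexMidpoint s(((x, 0) : HexVertex), t) ∈ K₂ := by
        refine mem_of_dist_le_of_mem_tsupport hK₂ hmid₀ ?_
        calc dist ((δ : ℂ) * hexMidpoint s(((x, 0) : HexVertex), t))
              ((δ : ℂ) * hexMidpoint s(((x, 0) : HexVertex), t₀))
            ≤ dist ((δ : ℂ) * hexMidpoint s(((x, 0) : HexVertex), t))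
                  ((δ : ℂ) * hexCenter ((x, 0) : HexVertex)) +
                dist ((δ : ℂ) * hexCenter ((x, 0) : HexVertex))
                  ((δ : ℂ) * hexMidpoint s(((x, 0) : HexVertex), t₀)) := dist_triangle _ _ _
          _ ≤ δ / 2 + δ / 2 := add_le_add (dist_mid_center_le hδ.le hadj) hcv
          _ ≤ r := by linarith
      have hedge : s(((x, 0) : HexVertex), t) ∈ hexDomainMidEdges Λ :=
        ⟨(SimpleGraph.mem_edgeSet _).2 hadj, t, Sym2.mem_mk_right _ _, htΛ⟩
      have hq := happ _ hedge hmidK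
      have hosc := hg ((δ : ℂ) * hexMidpoint s(((x, 0) : HexVertex), t))
        ((δ : ℂ) * hexCenter ((x, 0) : HexVertex)) (dist_mid_center_le hδ.le hadj)
      have hsplit : ψ ((δ : ℂ) * hexMidpoint s(((x, 0) : HexVertex), t)) * G s(((x, 0) : HexVertex), t) - gv =
          (ψ ((δ : ℂ) * hexMidpoint s(((x, 0) : HexVertex), t)) *
                f ((δ : ℂ) * hexMidpoint s(((x, 0) : HexVertex), t)) - gv) +
            ψ ((δ : ℂ) * hexMidpoint s(((x, 0) : HexVertex), t)) *
              (G s(((x, 0) : HexVertex), t) - f ((δ : ℂ) * hexMidpoint s(((x, 0) : HexVertex), t))) := by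
        ring
      rw [norm_mul, RCLike.norm_conj, hsplit]
      have h1 : ‖hexCenter t - hexCenter ((x, 0) : HexVertex)‖ ≤ 1 := norm_hexCenter_sub_le_one hadj
      have h2 : ‖(ψ ((δ : ℂ) * hexMidpoint s(((x, 0) : HexVertex), t)) *
                f ((δ : ℂ) * hexMidpoint s(((x, 0) : HexVertex), t)) - gv) +
            ψ ((δ : ℂ) * hexMidpoint s(((x, 0) : HexVertex), t)) *
              (G s(((x, 0) : HexVertex), t) - f ((δ : ℂ) * hexMidpoint s(((x, 0) : HexVertex), t)))‖ ≤
          η + Mψ * η := by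
        refine (norm_add_le _ _).trans (add_le_add hosc ?_)
        rw [norm_mul]
        exact mul_le_mul (hMψ _) hq (norm_nonneg _) hMψ0
      calc ‖hexCenter t - hexCenter ((x, 0) : HexVertex)‖ *
            ‖(ψ ((δ : ℂ) * hexMidpoint s(((x, 0) : HexVertex), t)) *
                  f ((δ : ℂ) * hexMidpoint s(((x, 0) : HexVertex), t)) - gv) +
              ψ ((δ : ℂ) * hexMidpoint s(((x, 0) : HexVertex), t)) *
                (G s(((x, 0) : HexVertex), t) - f ((δ : ℂ) * hexMidpoint s(((x, 0) : HexVertex), t)))‖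
          ≤ 1 * (η + Mψ * η) := mul_le_mul h1 h2 (norm_nonneg _) zero_le_one
        _ = (1 + Mψ) * η := by ring
    have hcard : ((Λ.filter fun t => hexGraph.Adj ((x, 0) : HexVertex) t).card : ℝ) ≤ 3 := by
      exact_mod_cast card_filter_adj_le_three x Λ
    have hpos : 0 ≤ (1 + Mψ) * η := by positivity
    calc ‖∑ t ∈ Λ.filter (fun t => hexGraph.Adj ((x, 0) : HexVertex) t),
            (starRingEnd ℂ) (hexCenter t - hexCenter ((x, 0) : HexVertex)) *
              (ψ ((δ : ℂ) * hexMidpoint s(((x, 0) : HexVertex), t)) * G s(((x, 0) : HexVertex), t) - gv)‖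
        ≤ ∑ t ∈ Λ.filter (fun t => hexGraph.Adj ((x, 0) : HexVertex) t),
            ‖(starRingEnd ℂ) (hexCenter t - hexCenter ((x, 0) : HexVertex)) *
              (ψ ((δ : ℂ) * hexMidpoint s(((x, 0) : HexVertex), t)) * G s(((x, 0) : HexVertex), t) - gv)‖ :=
          norm_sum_le _ _
      _ ≤ ∑ t ∈ Λ.filter (fun t => hexGraph.Adj ((x, 0) : HexVertex) t), (1 + Mψ) * η :=
          Finset.sum_le_sum hterm
      _ = ((Λ.filter fun t => hexGraph.Adj ((x, 0) : HexVertex) t).card : ℝ) * ((1 + Mψ) * η) := by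
          rw [Finset.sum_const, nsmul_eq_mul]
      _ ≤ 3 * ((1 + Mψ) * η) := mul_le_mul_of_nonneg_right hcard hpos
      _ = 3 * (1 + Mψ) * η := by ring
  · push Not at hex
    rw [Finset.sum_eq_zero fun t ht => by rw [hex t ht, zero_mul, zero_mul], norm_zero]
    split_ifs <;> positivity

end ConjugateClassNegligibleOfLimit

end Summit.CriticalPhenomena.SAWScalingLimit.Theorems
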